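import Literature.Analysis.FluidPDE.CaloricBackwardKernels
import Literature.Analysis.FluidPDE.HeatNewtonIdentity
import HarnessLib

/-!
# Off-diagonal bounds for the first two derivatives of the heat flow of the truncated Newtonian
# kernel

Analysis/FluidPDE support file for the discharge of the named fact
`Literature.Analysis.FluidPDE.NSBoundedInteriorContinuity` (`NSBoundedInteriorRegularity.lean`;
Seregin–Šverák 2009, §2). In the duality proof the pressure terms carrying derivatives of the
cut-off are space–time potentials of integrable data (the pressure) against the backward kernels
of `∂_c e^{aΔ}Γ₀ = heatD1 a c Γ₀` and `∂ᵥ∂_c e^{aΔ}Γ₀ = heatD2 a v c Γ₀`, `Γ₀ = θΓ` the truncated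
Newtonian kernel (`newtonNear r₀ r₁`); such potentials are continuous where the data and the
evaluation point are separated in space (`continuousOn_convolution_of_offDiag`), provided the
kernels are **bounded off the diagonal uniformly in the elapsed time `a > 0`**. This file proves
these bounds (`exists_abs_heatD1_newtonNear_le_of_le_norm`,
`exists_abs_heatD2_newtonNear_le_of_le_norm`: for `δ > 0` there is `B` with
`|heatD1 a c Γ₀ (x)|, |heatD2 a v c Γ₀ (x)| ≤ B` for all `a > 0`, `‖x‖ ≥ δ`), the global bound
`|heatD1 a c λ (x)| ≤ sup |∂_cλ|` for the smooth remainder `λ = Δ((1-θ)Γ)`, and the joint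
continuity of `(a, x) ↦ heatD2 a v c φ (x)` on `(0, ∞) × E` for `φ ∈ L¹`.

The mechanism (all dimensions): split `Γ₀ = χΓ₀ + (1-χ)Γ₀` with a cut-off `χ` of radius `δ/2`.
The near part `χΓ₀ ∈ L¹` is supported in `‖z‖ ≤ δ/2`, so at `‖x‖ ≥ δ` only kernel values
`∂G_a(y)`, `∂²G_a(y)` with `‖y‖ ≥ δ/2` enter, which are bounded uniformly in `a` by the Gaussian
decay against the parabolic distance (`|∂ᵥG_a(y)| ≤ C‖v‖(a+‖y‖²)^{-(d+1)/2}`,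
`|∂ᵥ∂_cG_a|`-weight `≤ C‖v‖‖c‖(a+‖y‖²)^{-(d+2)/2}`; Koch–Tataru 2001, §2 (8)); the far part
`(1-χ)Γ₀` is smooth and compactly supported, so the derivatives fall on it and the heat flow
contracts `L^∞`.

## References

* H. Koch, D. Tataru, Adv. Math. 157 (2001), §2 (8). [`KochTataruAdvMath2001`]
* G. B. Folland, *Introduction to PDE* (2nd ed.), §4.A Thm. (4.3) (derivatives of `e^{tΔ}f` as
  integrals against derivatives of the kernel). [`Folland1995PDE`]
-/

noncomputable section

open MeasureTheory Set Function Filter Metric Real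
open scoped ENNReal NNReal Topology RealInnerProductSpace Convolution

namespace Literature.Analysis.FluidPDE

section General

variable {E : Type*} [NormedAddCommGroup E] [InnerProductSpace ℝ E] [FiniteDimensional ℝ E]
  [MeasurableSpace E] [BorelSpace E]

/-! ### `heatD2` as an integral operator -/

/-- The weight of the mixed second derivative of the heat kernel,
`heatKernelHessWeight a v c z = (-(1/(2a)) ⟪v, c⟫ + ⟪z, v⟫⟪z, c⟫/(4a²)) G_a(z) = ∂ᵥ∂_cG_a(z)`
(`a ≠ 0`). [folklore] -/
def heatKernelHessWeight (a : ℝ) (v c z : E) : ℝ :=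
  (-(1 / (2 * a)) * ⟪v, c⟫ + (1 / (2 * a)) ^ 2 * (⟪z, c⟫ * ⟪z, v⟫)) *
    UnboundedOperators.heatKernel a z

/-- **Mixed second directional derivatives of `e^{aΔ}φ` as an integral** (`φ ∈ Lᵖ`, `a > 0`):
`heatD2 a v c φ (x) = ∫ ∂ᵥ∂_cG_a(x - y) φ(y) dy` (Folland, *Introduction to PDE*, Thm. (4.3):
differentiate `∂_c e^{aΔ}φ (x) = ∫ (-(1/2a))⟪x - y, c⟫ G_a(x - y) φ(y) dy` once more under the
integral). [cite: Folland1995PDE, §4.A Theorem (4.3)] -/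
theorem heatD2_eq_integral_heatKernelHessWeight {φ : E → ℝ} {p : ℝ≥0∞} (hφ : MemLp φ p volume)
    (hp : 1 ≤ p) {a : ℝ} (ha : 0 < a) (v c x : E) :
    heatD2 a v c φ x = ∫ y, heatKernelHessWeight a v c (x - y) * φ y := by
  have hV : (fun z : E => (-(1 / (2 * a))) • innerSL ℝ z).HasTemperateGrowth :=
    (Function.HasTemperateGrowth.const _).fun_smul (innerSL ℝ (E := E)).hasTemperateGrowth
  have hP : (fun z => ((-(1 / (2 * a))) • innerSL ℝ c : E →L[ℝ] ℝ) z).HasTemperateGrowth :=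
    ((-(1 / (2 * a))) • innerSL ℝ c : E →L[ℝ] ℝ).hasTemperateGrowth
  have h1 : (fun y => fderiv ℝ (UnboundedOperators.heatExtension φ a) y c) =
      fun y => ∫ w, ((fun z => ((-(1 / (2 * a))) • innerSL ℝ c : E →L[ℝ] ℝ) z) (y - w) *
        UnboundedOperators.heatKernel a (y - w)) • φ w := by
    funext y
    rw [UnboundedOperators.fderiv_heatExtension_apply_eq_integral ha hφ hp y c]
    refine integral_congr_ae (Eventually.of_forall fun w => ?_)
    simp [real_inner_comm]
  unfold heatD2
  rw [h1, UnboundedOperators.fderiv_integral_heatKernel_smul_apply ha hφ hp hP hV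
    (UnboundedOperators.hasFDerivAt_heatKernel_smul_innerSL a) x v]
  refine integral_congr_ae (Eventually.of_forall fun y => ?_)
  dsimp only
  have hfd : fderiv ℝ (fun z => ((-(1 / (2 * a))) • innerSL ℝ c : E →L[ℝ] ℝ) z) (x - y) =
      ((-(1 / (2 * a))) • innerSL ℝ c : E →L[ℝ] ℝ) :=
    ((-(1 / (2 * a))) • innerSL ℝ c : E →L[ℝ] ℝ).fderiv
  rw [hfd, smul_eq_mul, heatKernelHessWeight]
  congr 1
  simp only [_root_.add_apply, FunLike.coe_smul, Pi.smul_apply,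
    innerSL_apply_apply, smul_eq_mul, real_inner_comm c v, real_inner_comm c (x - y),
    real_inner_comm v (x - y)]
  ring

omit [FiniteDimensional ℝ E] [MeasurableSpace E] [BorelSpace E] in
/-- **Gaussian bound for the mixed second derivative of the heat kernel**: there is `C = C(E)`
with `|∂ᵥ∂_cG_a(z)| ≤ C ‖v‖ ‖c‖ (a + ‖z‖²)^{-(d+2)/2}` for `a > 0` (Koch–Tataru 2001, §2 (8)).
[folklore] -/
theorem exists_abs_heatKernelHessWeight_le :
    ∃ C : ℝ, 0 < C ∧ ∀ {a : ℝ}, 0 < a → ∀ v c z : E,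
      |heatKernelHessWeight a v c z| ≤
        C * ‖v‖ * ‖c‖ * (a + ‖z‖ ^ 2) ^ (-(((Module.finrank ℝ E : ℝ) + 2) / 2)) := by
  set d : ℝ := (Module.finrank ℝ E : ℝ) with hd
  obtain ⟨C₁, hC₁, h₁⟩ := exists_heatKernel_le_rpow (E := E) (d / 2 + 1)
  obtain ⟨C₂, hC₂, h₂⟩ := exists_heatKernel_le_rpow (E := E) (d / 2 + 2)
  refine ⟨C₁ / 2 + C₂ / 4, by positivity, fun {a} ha v c z => ?_⟩
  have haz : 0 < a + ‖z‖ ^ 2 := by positivity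
  have hG1 := h₁ ha z
  have hG2 := h₂ ha z
  rw [show d / 2 + 1 - (Module.finrank ℝ E : ℝ) / 2 = 1 by rw [hd]; ring, Real.rpow_one] at hG1
  rw [show d / 2 + 2 - (Module.finrank ℝ E : ℝ) / 2 = 2 by rw [hd]; ring] at hG2
  have hGpos := (UnboundedOperators.heatKernel_pos ha z).le
  rw [heatKernelHessWeight, abs_mul, abs_of_nonneg hGpos]
  have hvc : |⟪v, c⟫| ≤ ‖v‖ * ‖c‖ := abs_real_inner_le_norm v c
  have hzc : |⟪z, c⟫| ≤ ‖z‖ * ‖c‖ := abs_real_inner_le_norm z c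
  have hzv : |⟪z, v⟫| ≤ ‖z‖ * ‖v‖ := abs_real_inner_le_norm z v
  -- the two terms of the weight
  have hT1 : |(-(1 / (2 * a)) * ⟪v, c⟫)| * UnboundedOperators.heatKernel a z ≤
      C₁ / 2 * ‖v‖ * ‖c‖ * (a + ‖z‖ ^ 2) ^ (-(d / 2 + 1)) := by
    rw [abs_mul, abs_neg, abs_of_pos (by positivity : (0 : ℝ) < 1 / (2 * a))]
    calc 1 / (2 * a) * |⟪v, c⟫| * UnboundedOperators.heatKernel a z
        ≤ 1 / (2 * a) * (‖v‖ * ‖c‖) * (C₁ * a * (a + ‖z‖ ^ 2) ^ (-(d / 2 + 1))) := by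
          gcongr
      _ = C₁ / 2 * ‖v‖ * ‖c‖ * (a + ‖z‖ ^ 2) ^ (-(d / 2 + 1)) := by
          field_simp
  have hT2 : |(1 / (2 * a)) ^ 2 * (⟪z, c⟫ * ⟪z, v⟫)| * UnboundedOperators.heatKernel a z ≤
      C₂ / 4 * ‖v‖ * ‖c‖ * (a + ‖z‖ ^ 2) ^ (-(d / 2 + 1)) := by
    rw [abs_mul, abs_of_pos (by positivity : (0 : ℝ) < (1 / (2 * a)) ^ 2), abs_mul]
    have hz2 : ‖z‖ ^ 2 ≤ a + ‖z‖ ^ 2 := by linarith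
    calc (1 / (2 * a)) ^ 2 * (|⟪z, c⟫| * |⟪z, v⟫|) * UnboundedOperators.heatKernel a z
        ≤ (1 / (2 * a)) ^ 2 * (‖z‖ * ‖c‖ * (‖z‖ * ‖v‖)) *
            (C₂ * a ^ (2 : ℝ) * (a + ‖z‖ ^ 2) ^ (-(d / 2 + 2))) := by
          gcongr
      _ = C₂ / 4 * ‖v‖ * ‖c‖ * (‖z‖ ^ 2 * (a + ‖z‖ ^ 2) ^ (-(d / 2 + 2))) := by
          rw [Real.rpow_two]; field_simp; ring
      _ ≤ C₂ / 4 * ‖v‖ * ‖c‖ * ((a + ‖z‖ ^ 2) * (a + ‖z‖ ^ 2) ^ (-(d / 2 + 2))) := by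
          gcongr
      _ = C₂ / 4 * ‖v‖ * ‖c‖ * (a + ‖z‖ ^ 2) ^ (-(d / 2 + 1)) := by
          rw [show -(d / 2 + 1) = 1 + (-(d / 2 + 2)) by ring, Real.rpow_add haz, Real.rpow_one]
  have hexp : -(d / 2 + 1) = -((d + 2) / 2) := by ring
  rw [hexp] at hT1 hT2
  calc |(-(1 / (2 * a)) * ⟪v, c⟫ + (1 / (2 * a)) ^ 2 * (⟪z, c⟫ * ⟪z, v⟫))| *
        UnboundedOperators.heatKernel a z
      ≤ (|(-(1 / (2 * a)) * ⟪v, c⟫)| + |(1 / (2 * a)) ^ 2 * (⟪z, c⟫ * ⟪z, v⟫)|) *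
          UnboundedOperators.heatKernel a z :=
        mul_le_mul_of_nonneg_right (abs_add_le _ _) hGpos
    _ = |(-(1 / (2 * a)) * ⟪v, c⟫)| * UnboundedOperators.heatKernel a z +
          |(1 / (2 * a)) ^ 2 * (⟪z, c⟫ * ⟪z, v⟫)| * UnboundedOperators.heatKernel a z := by ring
    _ ≤ C₁ / 2 * ‖v‖ * ‖c‖ * (a + ‖z‖ ^ 2) ^ (-((d + 2) / 2)) +
          C₂ / 4 * ‖v‖ * ‖c‖ * (a + ‖z‖ ^ 2) ^ (-((d + 2) / 2)) := add_le_add hT1 hT2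
    _ = (C₁ / 2 + C₂ / 4) * ‖v‖ * ‖c‖ * (a + ‖z‖ ^ 2) ^ (-((d + 2) / 2)) := by ring

omit [FiniteDimensional ℝ E] [MeasurableSpace E] [BorelSpace E] in
/-- **Off-diagonal bound for the Hessian weight**: `|∂ᵥ∂_cG_a(z)| ≤ C ‖v‖ ‖c‖ ρ^{-(d+2)}` for
`a > 0`, `‖z‖ ≥ ρ > 0`. [folklore] -/
theorem exists_abs_heatKernelHessWeight_le_of_le_norm :
    ∃ C : ℝ, 0 < C ∧ ∀ {a : ℝ}, 0 < a → ∀ {ρ : ℝ}, 0 < ρ → ∀ v c z : E, ρ ≤ ‖z‖ →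
      |heatKernelHessWeight a v c z| ≤ C * ‖v‖ * ‖c‖ * ρ ^ (-((Module.finrank ℝ E : ℝ) + 2)) := by
  obtain ⟨C, hC, h⟩ := exists_abs_heatKernelHessWeight_le (E := E)
  refine ⟨C, hC, fun {a} ha {ρ} hρ v c z hz => (h ha v c z).trans ?_⟩
  have hd : 0 ≤ ((Module.finrank ℝ E : ℝ) + 2) / 2 := by positivity
  refine mul_le_mul_of_nonneg_left ?_ (by positivity)
  calc (a + ‖z‖ ^ 2) ^ (-(((Module.finrank ℝ E : ℝ) + 2) / 2))
      ≤ (ρ ^ 2) ^ (-(((Module.finrank ℝ E : ℝ) + 2) / 2)) := by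
        refine Real.rpow_le_rpow_of_nonpos (by positivity) ?_ (neg_nonpos.2 hd)
        nlinarith [pow_le_pow_left₀ hρ.le hz 2]
    _ = ρ ^ (-((Module.finrank ℝ E : ℝ) + 2)) := by
        rw [← Real.rpow_natCast, ← Real.rpow_mul hρ.le]
        congr 1; push_cast; ring

/-! ### Off-diagonal bounds for data supported in a small ball -/

/-- **Integral operators with kernels bounded off a ball**: if `|k(y)| ≤ B` for `‖y‖ ≥ ρ` and
`φ` vanishes off the closed ball of radius `ρ`, then `|∫ k(y) φ(x - y) dy| ≤ B ‖φ‖₁` for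
`‖x‖ ≥ 2ρ`. [folklore] -/
theorem abs_integral_mul_comp_sub_le_of_offDiag {k φ : E → ℝ} {ρ B : ℝ}
    (hk : ∀ y, ρ ≤ ‖y‖ → |k y| ≤ B) (hφ : ∀ z, ρ < ‖z‖ → φ z = 0) (hφi : Integrable φ volume)
    {x : E} (hx : 2 * ρ ≤ ‖x‖) :
    |∫ y, k y * φ (x - y)| ≤ B * ∫ y, |φ y| := by
  have hpt : ∀ y, |k y * φ (x - y)| ≤ B * |φ (x - y)| := by
    intro y
    rw [abs_mul]
    by_cases hy : ρ ≤ ‖y‖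
    · exact mul_le_mul_of_nonneg_right (hk y hy) (abs_nonneg _)
    · have : ρ < ‖x - y‖ := by
        have h1 : ‖x‖ - ‖y‖ ≤ ‖x - y‖ := norm_sub_norm_le x y
        push Not at hy
        linarith
      rw [hφ _ this]; simp
  have hint : Integrable (fun y => B * |φ (x - y)|) volume :=
    ((hφi.comp_sub_left x).abs).const_mul B
  calc |∫ y, k y * φ (x - y)| ≤ ∫ y, |k y * φ (x - y)| := abs_integral_le_integral_abs
    _ ≤ ∫ y, B * |φ (x - y)| :=
        integral_mono_of_nonneg (Eventually.of_forall fun y => abs_nonneg _) hint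
          (Eventually.of_forall hpt)
    _ = B * ∫ y, |φ y| := by
        rw [integral_const_mul]
        congr 1
        exact integral_sub_left_eq_self (fun y => |φ y|) volume x

/-- **Off-diagonal bound for `heatD1` of data supported in a ball**: if `φ ∈ L¹` vanishes off
`‖z‖ ≤ ρ`, then `|heatD1 a c φ (x)| ≤ C ‖c‖ ρ^{-(d+1)} ‖φ‖₁` for all `a > 0` and `‖x‖ ≥ 2ρ`.
[folklore] -/
theorem exists_abs_heatD1_le_of_support :
    ∃ C : ℝ, 0 < C ∧ ∀ {φ : E → ℝ} {ρ : ℝ}, 0 < ρ → (∀ z, ρ < ‖z‖ → φ z = 0) →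
      Integrable φ volume → ∀ {a : ℝ}, 0 < a → ∀ c x : E, 2 * ρ ≤ ‖x‖ →
        |heatD1 a c φ x| ≤ C * ‖c‖ * ρ ^ (-((Module.finrank ℝ E : ℝ) + 1)) * ∫ y, |φ y| := by
  obtain ⟨C, hC, h⟩ := exists_abs_heatKernelGrad_le_of_le_norm (E := E)
  refine ⟨C, hC, fun {φ} {ρ} hρ hφ hφi {a} ha c x hx => ?_⟩
  rw [heatD1_eq_integral ((memLp_one_iff_integrable).2 hφi) le_rfl ha c x]
  exact abs_integral_mul_comp_sub_le_of_offDiag (fun y hy => h ha hρ c y hy) hφ hφi hx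

/-- **Off-diagonal bound for `heatD2` of data supported in a ball**: if `φ ∈ L¹` vanishes off
`‖z‖ ≤ ρ`, then `|heatD2 a v c φ (x)| ≤ C ‖v‖ ‖c‖ ρ^{-(d+2)} ‖φ‖₁` for `a > 0`, `‖x‖ ≥ 2ρ`.
[folklore] -/
theorem exists_abs_heatD2_le_of_support :
    ∃ C : ℝ, 0 < C ∧ ∀ {φ : E → ℝ} {ρ : ℝ}, 0 < ρ → (∀ z, ρ < ‖z‖ → φ z = 0) →
      Integrable φ volume → ∀ {a : ℝ}, 0 < a → ∀ v c x : E, 2 * ρ ≤ ‖x‖ →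
        |heatD2 a v c φ x| ≤
          C * ‖v‖ * ‖c‖ * ρ ^ (-((Module.finrank ℝ E : ℝ) + 2)) * ∫ y, |φ y| := by
  obtain ⟨C, hC, h⟩ := exists_abs_heatKernelHessWeight_le_of_le_norm (E := E)
  refine ⟨C, hC, fun {φ} {ρ} hρ hφ hφi {a} ha v c x hx => ?_⟩
  rw [heatD2_eq_integral_heatKernelHessWeight ((memLp_one_iff_integrable).2 hφi) le_rfl ha v c x]
  -- rewrite `∫ w(x - y) φ(y) dy = ∫ w(y) φ(x - y) dy`
  have hswap : ∫ y, heatKernelHessWeight a v c (x - y) * φ y =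
      ∫ y, heatKernelHessWeight a v c y * φ (x - y) := by
    have := integral_sub_left_eq_self (fun y => heatKernelHessWeight a v c y * φ (x - y)) volume x
    simp only [sub_sub_cancel] at this
    exact this
  rw [hswap]
  exact abs_integral_mul_comp_sub_le_of_offDiag (fun y hy => h ha hρ v c y hy) hφ hφi hx

/-! ### Smooth compactly supported data: derivatives fall on the data -/

/-- `heatD1 a c ψ = e^{aΔ}(∂_cψ)` for `ψ ∈ C_c^∞`, hence `|heatD1 a c ψ (x)| ≤ sup |∂_cψ|`.
[folklore] -/
theorem abs_heatD1_le_of_contDiff {ψ : E → ℝ} (hψ : ContDiff ℝ ((⊤ : ℕ∞) : WithTop ℕ∞) ψ)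
    (hψc : HasCompactSupport ψ) {c : E} {B : ℝ} (hB : ∀ z, |fderiv ℝ ψ z c| ≤ B) {a : ℝ}
    (ha : 0 < a) (x : E) : |heatD1 a c ψ x| ≤ B := by
  have m0 : MemLp ψ 1 (volume : Measure E) := hψ.continuous.memLp_of_hasCompactSupport hψc
  have hψ₁ : ContDiff ℝ ((⊤ : ℕ∞) : WithTop ℕ∞) (fun z => fderiv ℝ ψ z c) :=
    (hψ.fderiv_right (m := ((⊤ : ℕ∞) : WithTop ℕ∞)) (by exact_mod_cast le_top)).clm_apply
      contDiff_const
  have m1 : MemLp (fun z => fderiv ℝ ψ z c) 1 (volume : Measure E) :=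
    hψ₁.continuous.memLp_of_hasCompactSupport (hψc.fderiv_apply ℝ c)
  rw [heatD1, UnboundedOperators.fderiv_heatExtension_apply_eq_heatExtension_fderiv
    (hψ.of_le (by exact_mod_cast le_top)) m0 le_rfl m1 le_rfl ha x, ← Real.norm_eq_abs]
  exact UnboundedOperators.norm_heatExtension_le (fun z => by rw [Real.norm_eq_abs]; exact hB z) ha x

/-- `heatD2 a v c ψ = e^{aΔ}(∂ᵥ∂_cψ)` for `ψ ∈ C_c^∞`, hence `|heatD2 a v c ψ (x)| ≤ sup |∂ᵥ∂_cψ|`.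
[folklore] -/
theorem abs_heatD2_le_of_contDiff {ψ : E → ℝ} (hψ : ContDiff ℝ ((⊤ : ℕ∞) : WithTop ℕ∞) ψ)
    (hψc : HasCompactSupport ψ) {v c : E} {B : ℝ}
    (hB : ∀ z, |fderiv ℝ (fun z' => fderiv ℝ ψ z' c) z v| ≤ B) {a : ℝ} (ha : 0 < a) (x : E) :
    |heatD2 a v c ψ x| ≤ B := by
  have m0 : MemLp ψ 1 (volume : Measure E) := hψ.continuous.memLp_of_hasCompactSupport hψc
  have hψ₁ : ContDiff ℝ ((⊤ : ℕ∞) : WithTop ℕ∞) (fun z => fderiv ℝ ψ z c) :=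
    (hψ.fderiv_right (m := ((⊤ : ℕ∞) : WithTop ℕ∞)) (by exact_mod_cast le_top)).clm_apply
      contDiff_const
  have hψ₁c : HasCompactSupport (fun z => fderiv ℝ ψ z c) := hψc.fderiv_apply ℝ c
  have m1 : MemLp (fun z => fderiv ℝ ψ z c) 1 (volume : Measure E) :=
    hψ₁.continuous.memLp_of_hasCompactSupport hψ₁c
  have hψ₂ : ContDiff ℝ ((⊤ : ℕ∞) : WithTop ℕ∞) (fun z => fderiv ℝ (fun z' => fderiv ℝ ψ z' c) z v) :=
    (hψ₁.fderiv_right (m := ((⊤ : ℕ∞) : WithTop ℕ∞)) (by exact_mod_cast le_top)).clm_apply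
      contDiff_const
  have m2 : MemLp (fun z => fderiv ℝ (fun z' => fderiv ℝ ψ z' c) z v) 1 (volume : Measure E) :=
    hψ₂.continuous.memLp_of_hasCompactSupport (hψ₁c.fderiv_apply ℝ v)
  have step1 : (fun y => fderiv ℝ (UnboundedOperators.heatExtension ψ a) y c) =
      UnboundedOperators.heatExtension (fun z' => fderiv ℝ ψ z' c) a :=
    funext fun y => UnboundedOperators.fderiv_heatExtension_apply_eq_heatExtension_fderiv
      (hψ.of_le (by exact_mod_cast le_top)) m0 le_rfl m1 le_rfl ha y
  rw [heatD2, step1, UnboundedOperators.fderiv_heatExtension_apply_eq_heatExtension_fderiv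
    (hψ₁.of_le (by exact_mod_cast le_top)) m1 le_rfl m2 le_rfl ha x, ← Real.norm_eq_abs]
  exact UnboundedOperators.norm_heatExtension_le (fun z => by rw [Real.norm_eq_abs]; exact hB z) ha x

omit [InnerProductSpace ℝ E] [FiniteDimensional ℝ E] [MeasurableSpace E] [BorelSpace E] in
/-- A continuous compactly supported real function is bounded in absolute value. [folklore] -/
theorem exists_abs_le_of_hasCompactSupport {f : E → ℝ} (hf : Continuous f)
    (hfc : HasCompactSupport f) : ∃ B : ℝ, ∀ z, |f z| ≤ B := by
  obtain ⟨B, hB⟩ := hfc.exists_bound_of_continuous hf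
  exact ⟨B, fun z => by rw [← Real.norm_eq_abs]; exact hB z⟩

/-! ### Linearity of `heatD1`, `heatD2` in the data -/

/-- `heatD1` is additive in `Lᵖ` data. [folklore] -/
theorem heatD1_add {φ ψ : E → ℝ} {p : ℝ≥0∞} (hφ : MemLp φ p volume) (hψ : MemLp ψ p volume)
    (hp : 1 ≤ p) {a : ℝ} (ha : 0 < a) (c : E) :
    heatD1 a c (φ + ψ) = heatD1 a c φ + heatD1 a c ψ := by
  funext x
  haveI : p.HolderConjugate (ENNReal.conjExponent p) := .conjExponent hp
  have hK : MemLp (fun z => fderiv ℝ (UnboundedOperators.heatKernel (E := E) a) z c)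
      (ENNReal.conjExponent p) volume :=
    UnboundedOperators.memLp_fderiv_heatKernel_apply ha c _
  have h1 : Integrable (fun y => fderiv ℝ (UnboundedOperators.heatKernel a) y c * φ (x - y)) :=
    UnboundedOperators.convolutionExistsAt_of_memLp (ContinuousLinearMap.lsmul ℝ ℝ) hK hφ x
  have h2 : Integrable (fun y => fderiv ℝ (UnboundedOperators.heatKernel a) y c * ψ (x - y)) :=
    UnboundedOperators.convolutionExistsAt_of_memLp (ContinuousLinearMap.lsmul ℝ ℝ) hK hψ x
  rw [Pi.add_apply, heatD1_eq_integral (hφ.add hψ) hp ha,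
    heatD1_eq_integral hφ hp ha, heatD1_eq_integral hψ hp ha,
    ← integral_add h1 h2]
  congr 1; funext y; rw [Pi.add_apply]; ring

/-- `heatD2` is additive in `Lᵖ` data. [folklore] -/
theorem heatD2_add {φ ψ : E → ℝ} {p : ℝ≥0∞} (hφ : MemLp φ p volume) (hψ : MemLp ψ p volume)
    (hp : 1 ≤ p) {a : ℝ} (ha : 0 < a) (v c : E) (x : E) :
    heatD2 a v c (φ + ψ) x = heatD2 a v c φ x + heatD2 a v c ψ x := by
  have h2 : 0 < a / 2 := by positivity
  have hsplit : a = a / 2 + a / 2 := by ring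
  rw [hsplit, heatD2_eq_heatD1_heatD1 (hφ.add hψ) hp h2 h2, heatD2_eq_heatD1_heatD1 hφ hp h2 h2,
    heatD2_eq_heatD1_heatD1 hψ hp h2 h2, heatD1_add hφ hψ hp h2 c,
    heatD1_add (memLp_heatD1 hφ hp h2 c) (memLp_heatD1 hψ hp h2 c) hp h2 v, Pi.add_apply]

/-! ### Joint continuity of `heatD2` -/

/-- **Joint continuity of `(a, x) ↦ heatD2 a v c φ (x)` on `(0, ∞) × E`** for `φ ∈ L¹` (two layers
of the inductive step `continuousOn_heatD1_param`, as in `continuousOn_uncurry_heatD3`).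
[folklore] -/
theorem continuousOn_uncurry_heatD2 {φ : E → ℝ} (hφ : MemLp φ 1 volume) (v c : E) :
    ContinuousOn (fun q : ℝ × E => heatD2 q.1 v c φ q.2) (Ioi 0 ×ˢ univ) := by
  rintro ⟨s₀, x₀⟩ ⟨hs₀', -⟩
  have hs₀ : 0 < s₀ := hs₀'
  set a : ℝ := s₀ / 3 with ha_def
  have ha : 0 < a := by positivity
  set S : Set ℝ := Ioi (2 * a) with hS_def
  have hSo : IsOpen S := isOpen_Ioi
  have hs₀S : s₀ ∈ S := by rw [hS_def, mem_Ioi, ha_def]; linarith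
  set Ψ₁ : ℝ → E → ℝ := fun s => heatD1 (s - a) c φ with hΨ₁
  have hΨ₁p : ∀ s ∈ S, MemLp (Ψ₁ s) 1 volume := fun s hs =>
    memLp_heatD1 hφ le_rfl (by rw [hS_def, mem_Ioi] at hs; linarith) c
  have hΨ₁c : ContinuousOn (Function.uncurry Ψ₁) (S ×ˢ univ) := by
    have h := UnboundedOperators.continuousOn_uncurry_fderiv_heatExtension_of_memLp hφ le_rfl c
    refine (h.comp (f := fun q : ℝ × E => (q.1 - a, q.2))
      ((continuous_fst.sub continuous_const).prodMk continuous_snd).continuousOn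
      fun q hq => ⟨?_, mem_univ _⟩).congr fun q hq => rfl
    have : 2 * a < q.1 := hq.1
    exact mem_Ioi.2 (by linarith)
  have hΨ₁b : ∀ s₁ ∈ S, ∃ M : ℝ, ∃ U ∈ 𝓝 s₁, ∀ s ∈ U, ∀ z, ‖Ψ₁ s z‖ ≤ M := by
    intro s₁ hs₁
    have hs₁' : 2 * a < s₁ := hs₁
    set d₀ : ℝ := (s₁ - a) / 2 with hd₀
    have hd₀0 : 0 < d₀ := by rw [hd₀]; linarith
    refine ⟨(4 * π * d₀) ^ (-(Module.finrank ℝ E : ℝ) / 2) * (Real.sqrt d₀)⁻¹ * ‖c‖ *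
      (eLpNorm φ 1 volume).toReal, Ioi (a + d₀), isOpen_Ioi.mem_nhds ?_, fun s hs z => ?_⟩
    · rw [mem_Ioi, hd₀]; linarith
    · rw [mem_Ioi] at hs
      exact norm_heatD1_le_of_le hφ hd₀0 (by linarith) c z
  have h2 : ContinuousOn (fun q : ℝ × E => heatD1 a v (Ψ₁ q.1) q.2) (S ×ˢ univ) :=
    continuousOn_heatD1_param hSo hΨ₁c hΨ₁b hΨ₁p le_rfl ha v
  have hrepr : ∀ q ∈ S ×ˢ (univ : Set E), heatD2 q.1 v c φ q.2 = heatD1 a v (Ψ₁ q.1) q.2 := by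
    rintro ⟨s, x⟩ ⟨hs, -⟩
    have hs' : 2 * a < s := hs
    have hd : 0 < s - a := by linarith
    have := heatD2_eq_heatD1_heatD1 hφ le_rfl ha hd v c
    rw [show a + (s - a) = s by ring] at this
    rw [this]
  have h3 : ContinuousOn (fun q : ℝ × E => heatD2 q.1 v c φ q.2) (S ×ˢ univ) := h2.congr hrepr
  exact (h3.continuousAt ((hSo.prod isOpen_univ).mem_nhds ⟨hs₀S, mem_univ _⟩)).continuousWithinAt

end General

/-! ### The truncated Newtonian kernel (dimension three) -/

section Newton

/-- Local notation for `ℝ³ = EuclideanSpace ℝ (Fin 3)`. -/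
local notation "ℝ³" => EuclideanSpace ℝ (Fin 3)

variable {r₀ r₁ : ℝ}

/-- The smooth far part of `Γ₀` at scale `δ`: `(1 - χ)Γ₀`, `χ = radialCutoff (δ/4) (δ/2)`, is smooth
(it vanishes on `‖z‖ ≤ δ/4` and `Γ₀` is smooth off the origin) and compactly supported.
[folklore] -/
theorem contDiff_hasCompactSupport_far_newtonNear (h₀ : 0 < r₀) (h₁ : r₀ < r₁) {δ : ℝ} (hδ : 0 < δ) :
    ContDiff ℝ ((⊤ : ℕ∞) : WithTop ℕ∞) (fun z : ℝ³ => (1 - radialCutoff (δ / 4) (δ / 2) z) * newtonNear r₀ r₁ z) ∧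
    HasCompactSupport (fun z : ℝ³ => (1 - radialCutoff (δ / 4) (δ / 2) z) * newtonNear r₀ r₁ z) := by
  have hδ4 : 0 ≤ δ / 4 := by positivity
  have hδ42 : δ / 4 < δ / 2 := by linarith
  constructor
  · refine contDiff_iff_contDiffAt.2 fun z => ?_
    by_cases hz : z = 0
    · -- vanishes near the origin
      have hev : (fun z : ℝ³ => (1 - radialCutoff (δ / 4) (δ / 2) z) * newtonNear r₀ r₁ z) =ᶠ[𝓝 z]
          fun _ => 0 := by
        have ho : IsOpen (ball (0 : ℝ³) (δ / 4)) := isOpen_ball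
        filter_upwards [ho.mem_nhds (by rw [hz]; exact mem_ball_self (by positivity))] with y hy
        rw [mem_ball_zero_iff] at hy
        rw [radialCutoff_eq_one hδ4 hδ42 hy.le]; ring
      exact (contDiffAt_const.congr_of_eventuallyEq hev)
    · have h1 : ContDiffAt ℝ ((⊤ : ℕ∞) : WithTop ℕ∞) (fun z : ℝ³ => 1 - radialCutoff (δ / 4) (δ / 2) z) z :=
        (contDiff_const.sub (radialCutoff_contDiff (E' := ℝ³) (δ / 4) (δ / 2))).contDiffAt
      have h2 : ContDiffAt ℝ ((⊤ : ℕ∞) : WithTop ℕ∞) (newtonNear r₀ r₁) z := by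
        unfold newtonNear
        exact (radialCutoff_contDiff (E' := ℝ³) r₀ r₁).contDiffAt.mul (contDiffAt_newtonKernel hz)
      exact h1.mul h2
  · refine (hasCompactSupport_newtonNear h₀.le h₁).mono' ?_
    intro z hz
    exact subset_tsupport _ (right_ne_zero_of_mul hz)

/-- The near part `χΓ₀` vanishes off `‖z‖ ≤ δ/2` and is integrable. [folklore] -/
theorem near_newtonNear_props (h₀ : 0 < r₀) (h₁ : r₀ < r₁) {δ : ℝ} (hδ : 0 < δ) :
    (∀ z : ℝ³, δ / 2 < ‖z‖ → radialCutoff (δ / 4) (δ / 2) z * newtonNear r₀ r₁ z = 0) ∧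
    Integrable (fun z : ℝ³ => radialCutoff (δ / 4) (δ / 2) z * newtonNear r₀ r₁ z) volume := by
  have hδ4 : 0 ≤ δ / 4 := by positivity
  have hδ42 : δ / 4 < δ / 2 := by linarith
  refine ⟨fun z hz => by rw [radialCutoff_eq_zero hδ4 hδ42 hz.le, zero_mul], ?_⟩
  refine (integrable_newtonNear h₀.le h₁).bdd_mul (c := 1)
    (radialCutoff_contDiff (E' := ℝ³) (δ / 4) (δ / 2) (n := 0)).continuous.aestronglyMeasurable
    (Eventually.of_forall fun z => ?_)
  rw [Real.norm_eq_abs]; exact abs_radialCutoff_le_one _ _ _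

/-- **Off-diagonal bound for `heatD1` of the truncated Newtonian kernel**: for `0 < r₀ < r₁`,
`δ > 0` and `c` there is `B` with `|heatD1 a c Γ₀ (x)| ≤ B` for all `a > 0` and `‖x‖ ≥ δ`.
[folklore] -/
theorem exists_abs_heatD1_newtonNear_le_of_le_norm (h₀ : 0 < r₀) (h₁ : r₀ < r₁) {δ : ℝ}
    (hδ : 0 < δ) (c : ℝ³) :
    ∃ B : ℝ, 0 ≤ B ∧ ∀ {a : ℝ}, 0 < a → ∀ x : ℝ³, δ ≤ ‖x‖ → |heatD1 a c (newtonNear r₀ r₁) x| ≤ B := by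
  obtain ⟨C, hC, hnear⟩ := exists_abs_heatD1_le_of_support (E := ℝ³)
  obtain ⟨hφ₁0, hφ₁i⟩ := near_newtonNear_props h₀ h₁ hδ
  obtain ⟨hφ₂, hφ₂c⟩ := contDiff_hasCompactSupport_far_newtonNear h₀ h₁ hδ
  set φ₁ : ℝ³ → ℝ := fun z => radialCutoff (δ / 4) (δ / 2) z * newtonNear r₀ r₁ z with hφ₁
  set φ₂ : ℝ³ → ℝ := fun z => (1 - radialCutoff (δ / 4) (δ / 2) z) * newtonNear r₀ r₁ z with hφ₂_def
  -- bound for the derivative of the far part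
  have hφ₂' : ContDiff ℝ ((⊤ : ℕ∞) : WithTop ℕ∞) (fun z => fderiv ℝ φ₂ z c) :=
    (hφ₂.fderiv_right (m := ((⊤ : ℕ∞) : WithTop ℕ∞)) (by exact_mod_cast le_top)).clm_apply
      contDiff_const
  obtain ⟨B₂, hB₂⟩ := exists_abs_le_of_hasCompactSupport hφ₂'.continuous (hφ₂c.fderiv_apply ℝ c)
  have hB₂0 : 0 ≤ B₂ := (abs_nonneg _).trans (hB₂ 0)
  set B₁ : ℝ := C * ‖c‖ * (δ / 2) ^ (-((Module.finrank ℝ ℝ³ : ℝ) + 1)) * ∫ y, |φ₁ y| with hB₁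
  have hB₁0 : 0 ≤ B₁ := by
    rw [hB₁]
    have : 0 ≤ ∫ y, |φ₁ y| := integral_nonneg fun y => abs_nonneg _
    have : 0 ≤ (δ / 2) ^ (-((Module.finrank ℝ ℝ³ : ℝ) + 1)) := Real.rpow_nonneg (by positivity) _
    positivity
  refine ⟨B₁ + B₂, by positivity, fun {a} ha x hx => ?_⟩
  have hsplit : newtonNear r₀ r₁ = φ₁ + φ₂ := by
    funext z; simp only [hφ₁, hφ₂_def, Pi.add_apply]; ring
  have m1 : MemLp φ₁ 1 (volume : Measure ℝ³) := (memLp_one_iff_integrable).2 hφ₁i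
  have m2 : MemLp φ₂ 1 (volume : Measure ℝ³) := hφ₂.continuous.memLp_of_hasCompactSupport hφ₂c
  rw [hsplit, heatD1_add m1 m2 le_rfl ha c, Pi.add_apply]
  refine (abs_add_le _ _).trans (add_le_add ?_ ?_)
  · exact hnear (by positivity : 0 < δ / 2) hφ₁0 hφ₁i ha c x (by linarith)
  · exact abs_heatD1_le_of_contDiff hφ₂ hφ₂c hB₂ ha x

/-- **Off-diagonal bound for `heatD2` of the truncated Newtonian kernel**: for `0 < r₀ < r₁`,
`δ > 0` and `v, c` there is `B` with `|heatD2 a v c Γ₀ (x)| ≤ B` for all `a > 0` and `‖x‖ ≥ δ`.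
[folklore] -/
theorem exists_abs_heatD2_newtonNear_le_of_le_norm (h₀ : 0 < r₀) (h₁ : r₀ < r₁) {δ : ℝ}
    (hδ : 0 < δ) (v c : ℝ³) :
    ∃ B : ℝ, 0 ≤ B ∧ ∀ {a : ℝ}, 0 < a → ∀ x : ℝ³, δ ≤ ‖x‖ →
      |heatD2 a v c (newtonNear r₀ r₁) x| ≤ B := by
  obtain ⟨C, hC, hnear⟩ := exists_abs_heatD2_le_of_support (E := ℝ³)
  obtain ⟨hφ₁0, hφ₁i⟩ := near_newtonNear_props h₀ h₁ hδ
  obtain ⟨hφ₂, hφ₂c⟩ := contDiff_hasCompactSupport_far_newtonNear h₀ h₁ hδ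
  set φ₁ : ℝ³ → ℝ := fun z => radialCutoff (δ / 4) (δ / 2) z * newtonNear r₀ r₁ z with hφ₁
  set φ₂ : ℝ³ → ℝ := fun z => (1 - radialCutoff (δ / 4) (δ / 2) z) * newtonNear r₀ r₁ z with hφ₂_def
  have hφ₂' : ContDiff ℝ ((⊤ : ℕ∞) : WithTop ℕ∞) (fun z => fderiv ℝ φ₂ z c) :=
    (hφ₂.fderiv_right (m := ((⊤ : ℕ∞) : WithTop ℕ∞)) (by exact_mod_cast le_top)).clm_apply
      contDiff_const
  have hφ₂'' : ContDiff ℝ ((⊤ : ℕ∞) : WithTop ℕ∞) (fun z => fderiv ℝ (fun z' => fderiv ℝ φ₂ z' c) z v) :=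
    (hφ₂'.fderiv_right (m := ((⊤ : ℕ∞) : WithTop ℕ∞)) (by exact_mod_cast le_top)).clm_apply
      contDiff_const
  obtain ⟨B₂, hB₂⟩ := exists_abs_le_of_hasCompactSupport hφ₂''.continuous
    ((hφ₂c.fderiv_apply ℝ c).fderiv_apply ℝ v)
  have hB₂0 : 0 ≤ B₂ := (abs_nonneg _).trans (hB₂ 0)
  set B₁ : ℝ := C * ‖v‖ * ‖c‖ * (δ / 2) ^ (-((Module.finrank ℝ ℝ³ : ℝ) + 2)) * ∫ y, |φ₁ y| with hB₁
  have hB₁0 : 0 ≤ B₁ := by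
    rw [hB₁]
    have : 0 ≤ ∫ y, |φ₁ y| := integral_nonneg fun y => abs_nonneg _
    have : 0 ≤ (δ / 2) ^ (-((Module.finrank ℝ ℝ³ : ℝ) + 2)) := Real.rpow_nonneg (by positivity) _
    positivity
  refine ⟨B₁ + B₂, by positivity, fun {a} ha x hx => ?_⟩
  have hsplit : newtonNear r₀ r₁ = φ₁ + φ₂ := by
    funext z; simp only [hφ₁, hφ₂_def, Pi.add_apply]; ring
  have m1 : MemLp φ₁ 1 (volume : Measure ℝ³) := (memLp_one_iff_integrable).2 hφ₁i
  have m2 : MemLp φ₂ 1 (volume : Measure ℝ³) := hφ₂.continuous.memLp_of_hasCompactSupport hφ₂c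
  rw [hsplit, heatD2_add m1 m2 le_rfl ha v c x]
  refine (abs_add_le _ _).trans (add_le_add ?_ ?_)
  · exact hnear (by positivity : 0 < δ / 2) hφ₁0 hφ₁i ha v c x (by linarith)
  · exact abs_heatD2_le_of_contDiff hφ₂ hφ₂c hB₂ ha x

/-- **Global bound for `heatD1` of the smoothing remainder `λ = Δ((1-θ)Γ)`**:
`|heatD1 a c λ (x)| ≤ sup |∂_cλ|` for all `a > 0`, `x`. [folklore] -/
theorem exists_abs_heatD1_newtonFarLaplacian_le (h₀ : 0 < r₀) (h₁ : r₀ < r₁) (c : ℝ³) :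
    ∃ B : ℝ, 0 ≤ B ∧ ∀ {a : ℝ}, 0 < a → ∀ x : ℝ³, |heatD1 a c (newtonFarLaplacian r₀ r₁) x| ≤ B := by
  have hl1 : ContDiff ℝ ((⊤ : ℕ∞) : WithTop ℕ∞) (newtonFarLaplacian r₀ r₁) :=
    contDiff_newtonFarLaplacian h₀ h₁
  have hlc := hasCompactSupport_newtonFarLaplacian h₀.le h₁
  have hl' : ContDiff ℝ ((⊤ : ℕ∞) : WithTop ℕ∞) (fun z => fderiv ℝ (newtonFarLaplacian r₀ r₁) z c) :=
    (hl1.fderiv_right (m := ((⊤ : ℕ∞) : WithTop ℕ∞)) (by exact_mod_cast le_top)).clm_apply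
      contDiff_const
  obtain ⟨B, hB⟩ := exists_abs_le_of_hasCompactSupport hl'.continuous (hlc.fderiv_apply ℝ c)
  exact ⟨B, (abs_nonneg _).trans (hB 0), fun {a} ha x => abs_heatD1_le_of_contDiff hl1 hlc hB ha x⟩

end Newton

end Literature.Analysis.FluidPDE
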